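import Literature.Analysis.FluidPDE.NSLerayOseenRepresentation
import HarnessLib

/-!
# Bounded duality-form mild solutions WITH A FORCE IN PAIR FORM solve the Oseen integral equation
  up to a constant (the KNSS drift)

Analysis/FluidPDE support file (everything proved) for the perturbation step of M. P. Coiculescu,
S. Palasek, *Non-uniqueness of smooth solutions of the Navier–Stokes equations from critical data*,
Invent. Math. 244 (2025) = arXiv:2503.14699, §4.1 eq. (4.1) and §5 ¶1 (hypothesis `hB` of
`Literature.Barriers.NavierStokesRegularity.CriticalDataSmoothNonuniqueness_of_principalParts_of_perturbationThreshold`):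
the principal part `v` solves (NSE) with the residual force `-ℙ div F`, and the construction of
the correction `w` is carried out in the Oseen (mild, kernel) form. This file is the first half of
the bridge "classical with force ⇒ Oseen form": the tree's (A1) argument
`exists_const_oseenMild_of_bounded_isMildNSSolutionOn` (Koch–Nadirashvili–Seregin–Šverák 2009,
Lemma 3.1 / Rem. 3.1: bounded very weak solutions are mild up to the drift `b(t)`), run with a
FORCE whose tested form is reproduced by finitely many Oseen–Duhamel pairs:

* `exists_const_forced_oseenMild_of_bounded_isMildNSSolutionOn` — if `u` is bounded and
  jointly measurable with the duality identities `IsMildNSSolutionOn (Ioc 0 T) ν f (u 0) u`, and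
  the force term satisfies `∫₀ᵗ∫⟪f, e^{ν(t-τ)Δ}φ⟫ = -Σᵢ ∫⟪B^ν_0(aᵢ, bᵢ)(t), φ⟫` for every
  divergence-free test `φ` (bounded jointly measurable pairs `(aᵢ, bᵢ)`; for `f = -div F` with a
  smooth bounded symmetric `F` the pairs are `(eⱼ, Fᵢⱼ eᵢ)`, an integration by parts), then for
  every `t ∈ (0, T]` there is a constant `c` with
  `u(t) = e^{νtΔ}u(0) - B^ν_0(u,u)(t) - Σᵢ B^ν_0(aᵢ,bᵢ)(t) - c` a.e.

For periodic mean-zero fields the constant is then killed by cell averages (sibling file).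

## References

* G. Koch, N. Nadirashvili, G. Seregin, V. Šverák, Acta Math. 203 (2009) = arXiv:0709.3599,
  Lemma 3.1 and Rem. 3.1 (p. 7), §4 p. 8. [`KochNadirashviliSereginSverak2009`]
* M. P. Coiculescu, S. Palasek, Invent. Math. 244 (2025) = arXiv:2503.14699, §4.1 (4.1), §5 ¶1.
  [`CoiculescuPalasek2025`]
-/

noncomputable section

open MeasureTheory Set Function Filter TopologicalSpace InnerProductSpace Metric
open _root_.Topology
open scoped RealInnerProductSpace NNReal ENNReal

namespace Literature.Analysis.FluidPDE

variable {E : Type*} [NormedAddCommGroup E] [InnerProductSpace ℝ E] [FiniteDimensional ℝ E]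
  [MeasurableSpace E] [BorelSpace E]
variable {ι : Type*} [Fintype ι]

/-- **Bounded duality-form mild solutions with a force in pair form are Oseen-mild up to a
constant** (the (A1) argument of `exists_const_oseenMild_of_bounded_isMildNSSolutionOn` with a
force; KNSS 2009, Lemma 3.1 / Rem. 3.1). Hypotheses: `ν > 0`; `u` jointly measurable on
`(0, T) × E` with measurable slices bounded by `M` on `[0, T]`, weakly divergence-free datum `u 0`,
and the duality identities `IsMildNSSolutionOn (Ioc 0 T) ν f (u 0) u`; bounded jointly measurable
pairs `(aᵢ, bᵢ)` (bound `M'`) such that for every `t ∈ (0,T]` and every divergence-free test field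
`φ`, `∫₀ᵗ∫⟪f τ, e^{ν(t-τ)Δ}φ⟫ = -Σᵢ ∫⟪B^ν_0(aᵢ,bᵢ)(t), φ⟫`. Conclusion: for `t ∈ (0, T]` there is
`c` with `u(t) = e^{νtΔ}u(0) - B^ν_0(u,u)(t) - Σᵢ B^ν_0(aᵢ,bᵢ)(t) - c` a.e. Proof: the field
`z = e^{νtΔ}u(0) - B(u,u) - Σ B(aᵢ,bᵢ) - u(t)` is bounded, weakly divergence free, and annihilates
divergence-free tests (the duality identity), hence is a.e. constant
(`IsWeaklyDivFree.exists_ae_eq_const_of_norm_le_of_forall_integral_inner_eq_zero`).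
[cite: KochNadirashviliSereginSverak2009, Lemma 3.1 and Rem. 3.1 (arXiv:0709.3599 p. 7)] -/
theorem exists_const_forced_oseenMild_of_bounded_isMildNSSolutionOn {ν T M M' : ℝ}
    {f u : ℝ → E → E} {a b : ι → ℝ → E → E} (hν : 0 < ν) (hT : 0 < T)
    (hmild : IsMildNSSolutionOn (Ioc 0 T) ν f (u 0) u)
    (hmeas : AEStronglyMeasurable (uncurry u) ((volume : Measure (ℝ × E)).restrict (Ioo 0 T ×ˢ univ)))
    (hsl : ∀ t ∈ Icc 0 T, AEStronglyMeasurable (u t) volume) (hM : 0 < M)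
    (hbd : ∀ t ∈ Icc 0 T, ∀ y, ‖u t y‖ ≤ M) (hdiv0 : IsWeaklyDivFree (u 0))
    (ham : ∀ i, AEStronglyMeasurable (uncurry (a i))
      ((volume : Measure (ℝ × E)).restrict (Ioo 0 T ×ˢ univ)))
    (hbm : ∀ i, AEStronglyMeasurable (uncurry (b i))
      ((volume : Measure (ℝ × E)).restrict (Ioo 0 T ×ˢ univ)))
    (hM' : 0 < M') (haM : ∀ i, ∀ τ ∈ Ioo 0 T, ∀ y, ‖a i τ y‖ ≤ M')
    (hbM : ∀ i, ∀ τ ∈ Ioo 0 T, ∀ y, ‖b i τ y‖ ≤ M')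
    (hpair : ∀ t ∈ Ioc 0 T, ∀ φ : E → E, FunctionSpaces.IsTestFunctionOn (⊤ : Opens E) φ →
      VectorCalculus.IsDivFree φ →
      (∫ τ in (0 : ℝ)..t, ∫ x, ⟪f τ x, heatTest ν φ (t - τ) x⟫) =
        -∑ i, ∫ x, ⟪oseenDuhamel ν 0 (a i) (b i) t x, φ x⟫)
    {t : ℝ} (ht : t ∈ Ioc 0 T) :
    ∃ c : E, u t =ᵐ[volume] fun x =>
      UnboundedOperators.heatExtension (u 0) (ν * t) x - oseenDuhamel ν 0 u u t x -
        (∑ i, oseenDuhamel ν 0 (a i) (b i) t x) - c := by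
  haveI : CompleteSpace E := FiniteDimensional.complete ℝ E
  have h0I : (0 : ℝ) ∈ Icc 0 T := ⟨le_rfl, hT.le⟩
  have htI : t ∈ Icc 0 T := ⟨ht.1.le, ht.2⟩
  have hbd' : ∀ τ ∈ Ioo 0 T, ∀ y, ‖u τ y‖ ≤ M := fun τ hτ y => hbd τ ⟨hτ.1.le, hτ.2.le⟩ y
  have hνt : 0 < ν * t := mul_pos hν ht.1
  -- the four bounded pieces
  set h : E → E := UnboundedOperators.heatExtension (u 0) (ν * t) with hh
  set Bt : E → E := oseenDuhamel ν 0 u u t with hBt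
  set Φ : E → E := fun x => ∑ i, oseenDuhamel ν 0 (a i) (b i) t x with hΦ
  have hu0m : MemLp (u 0) ∞ (volume : Measure E) :=
    memLp_top_of_bound (hsl 0 h0I) M (Eventually.of_forall (hbd 0 h0I))
  have hh_cont : Continuous h :=
    (UnboundedOperators.contDiff_heatExtension_holds hu0m le_top hνt).continuous
  have hh_bd : ∀ x, ‖h x‖ ≤ M := fun x => UnboundedOperators.norm_heatExtension_le (hbd 0 h0I) hνt x
  have hh_m : MemLp h ∞ (volume : Measure E) :=
    memLp_top_of_bound hh_cont.aestronglyMeasurable M (Eventually.of_forall hh_bd)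
  obtain ⟨CB, hCB, hCBle⟩ := exists_norm_oseenDuhamel_bounded_le (E := E)
  have hBt_bd : ∀ x, ‖Bt x‖ ≤ CB * M ^ 2 * ν ^ (-(1 / 2 : ℝ)) * (2 * Real.sqrt (t - 0)) := fun x =>
    hCBle hν ht.1 hM.le (fun τ hτ y => hbd' τ ⟨hτ.1, hτ.2.trans_le ht.2⟩ y)
      (fun τ hτ y => hbd' τ ⟨hτ.1, hτ.2.trans_le ht.2⟩ y) x
  have hBt_meas : AEStronglyMeasurable Bt (volume : Measure E) :=
    aestronglyMeasurable_oseenDuhamel hν hmeas hmeas hM.le hbd' hbd' ht.1 ht.2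
  have hBt_m : MemLp Bt ∞ (volume : Measure E) :=
    memLp_top_of_bound hBt_meas _ (Eventually.of_forall hBt_bd)
  -- the forcing pieces
  have hPi_bd : ∀ i, ∀ x, ‖oseenDuhamel ν 0 (a i) (b i) t x‖ ≤
      CB * M' ^ 2 * ν ^ (-(1 / 2 : ℝ)) * (2 * Real.sqrt (t - 0)) := fun i x =>
    hCBle hν ht.1 hM'.le (fun τ hτ y => haM i τ ⟨hτ.1, hτ.2.trans_le ht.2⟩ y)
      (fun τ hτ y => hbM i τ ⟨hτ.1, hτ.2.trans_le ht.2⟩ y) x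
  have hPi_meas : ∀ i, AEStronglyMeasurable (oseenDuhamel ν 0 (a i) (b i) t) (volume : Measure E) :=
    fun i => aestronglyMeasurable_oseenDuhamel hν (ham i) (hbm i) hM'.le (haM i) (hbM i) ht.1 ht.2
  have hPi_m : ∀ i, MemLp (oseenDuhamel ν 0 (a i) (b i) t) ∞ (volume : Measure E) := fun i =>
    memLp_top_of_bound (hPi_meas i) _ (Eventually.of_forall (hPi_bd i))
  have hΦ_eq : Φ = ∑ i, oseenDuhamel ν 0 (a i) (b i) t := by
    funext x; simp only [hΦ, Finset.sum_apply]
  have hΦ_meas : AEStronglyMeasurable Φ (volume : Measure E) := by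
    rw [hΦ_eq]
    exact Finset.aestronglyMeasurable_sum _ fun i _ => hPi_meas i
  have hΦ_bd : ∀ x, ‖Φ x‖ ≤ ∑ _i : ι, CB * M' ^ 2 * ν ^ (-(1 / 2 : ℝ)) * (2 * Real.sqrt (t - 0)) :=
    fun x => (norm_sum_le _ _).trans (Finset.sum_le_sum fun i _ => hPi_bd i x)
  have hΦ_m : MemLp Φ ∞ (volume : Measure E) :=
    memLp_top_of_bound hΦ_meas _ (Eventually.of_forall hΦ_bd)
  have hut_m : MemLp (u t) ∞ (volume : Measure E) :=
    memLp_top_of_bound (hsl t htI) M (Eventually.of_forall (hbd t htI))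
  -- the field `z = h - Bt - Φ - u t`
  set z : E → E := fun x => h x - Bt x - Φ x - u t x with hz
  have hz_meas : AEStronglyMeasurable z volume :=
    ((hh_cont.aestronglyMeasurable.sub hBt_meas).sub hΦ_meas).sub (hsl t htI)
  have hz_bd : ∀ x, ‖z x‖ ≤ M + CB * M ^ 2 * ν ^ (-(1 / 2 : ℝ)) * (2 * Real.sqrt (t - 0)) +
      (∑ _i : ι, CB * M' ^ 2 * ν ^ (-(1 / 2 : ℝ)) * (2 * Real.sqrt (t - 0))) + M := by
    intro x
    calc ‖z x‖ ≤ ‖h x - Bt x - Φ x‖ + ‖u t x‖ := norm_sub_le _ _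
      _ ≤ (‖h x - Bt x‖ + ‖Φ x‖) + ‖u t x‖ := by gcongr; exact norm_sub_le _ _
      _ ≤ ((‖h x‖ + ‖Bt x‖) + ‖Φ x‖) + ‖u t x‖ := by gcongr; exact norm_sub_le _ _
      _ ≤ ((M + CB * M ^ 2 * ν ^ (-(1 / 2 : ℝ)) * (2 * Real.sqrt (t - 0))) +
            (∑ _i : ι, CB * M' ^ 2 * ν ^ (-(1 / 2 : ℝ)) * (2 * Real.sqrt (t - 0)))) + M := by
          gcongr
          · exact hh_bd x
          · exact hBt_bd x
          · exact hΦ_bd x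
          · exact hbd t htI x
      _ = _ := by ring
  -- weak divergence freeness of `z`
  have hdivh : IsWeaklyDivFree h := hdiv0.heatExtension_of_bound (hsl 0 h0I) (hbd 0 h0I) hνt
  have hdivB : IsWeaklyDivFree Bt :=
    isWeaklyDivFree_oseenDuhamel hν hmeas hmeas hM.le hbd' hbd' ht.1 ht.2
  have hdivPi : ∀ i, IsWeaklyDivFree (oseenDuhamel ν 0 (a i) (b i) t) := fun i =>
    isWeaklyDivFree_oseenDuhamel hν (ham i) (hbm i) hM'.le (haM i) (hbM i) ht.1 ht.2
  have hdivΦ : IsWeaklyDivFree Φ := by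
    -- finite sums of bounded weakly divergence-free fields
    have key : ∀ s : Finset ι, IsWeaklyDivFree (∑ i ∈ s, oseenDuhamel ν 0 (a i) (b i) t) ∧
        MemLp (∑ i ∈ s, oseenDuhamel ν 0 (a i) (b i) t) ∞ (volume : Measure E) := by
      intro s
      classical
      induction s using Finset.induction_on with
      | empty =>
        refine ⟨?_, ?_⟩
        · intro θ hθ; simp
        · rw [Finset.sum_empty]; exact memLp_top_const (0 : E)
      | insert i s hi ih =>
        rw [Finset.sum_insert hi]
        have hsub : IsWeaklyDivFree (oseenDuhamel ν 0 (a i) (b i) t - (-∑ j ∈ s, oseenDuhamel ν 0 (a j) (b j) t)) :=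
          IsWeaklyDivFree.sub le_top (hdivPi i) ?_ (hPi_m i) ih.2.neg
        · refine ⟨by simpa [sub_neg_eq_add] using hsub, (hPi_m i).add ih.2⟩
        · -- `-Σ` is weakly divergence free
          have h0 : IsWeaklyDivFree ((0 : E → E) - ∑ j ∈ s, oseenDuhamel ν 0 (a j) (b j) t) :=
            IsWeaklyDivFree.sub le_top (fun θ hθ => by simp) ih.1 (memLp_top_const (0 : E)) ih.2
          simpa using h0
    rw [hΦ_eq]
    exact (key Finset.univ).1
  have hdivut : IsWeaklyDivFree (u t) := hmild.1 t ht
  have hz_div : IsWeaklyDivFree z := by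
    have h1 : IsWeaklyDivFree (h - Bt) := IsWeaklyDivFree.sub le_top hdivh hdivB hh_m hBt_m
    have h2 : IsWeaklyDivFree (h - Bt - Φ) := IsWeaklyDivFree.sub le_top h1 hdivΦ (hh_m.sub hBt_m) hΦ_m
    have h3 : IsWeaklyDivFree (h - Bt - Φ - u t) :=
      IsWeaklyDivFree.sub le_top h2 hdivut ((hh_m.sub hBt_m).sub hΦ_m) hut_m
    exact h3
  -- `z` annihilates divergence-free test fields: the duality identity at `t`
  have hz_orth : ∀ φ : E → E, FunctionSpaces.IsTestFunctionOn (⊤ : Opens E) φ →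
      VectorCalculus.IsDivFree φ → ∫ x, ⟪z x, φ x⟫ = 0 := by
    intro φ hφ hφd
    have hφc := hφ.hasCompactSupport
    have hφcont := hφ.contDiff.continuous
    have key := hmild.2 t ht φ hφ hφd
    rw [hpair t ht φ hφ hφd] at key
    -- the pairings
    have e1 : ∫ x, ⟪h x, φ x⟫ = ∫ x, ⟪u 0 x, heatTest ν φ t x⟫ := by
      rw [hh, integral_inner_heatExtension_comm_of_bound (hsl 0 h0I) (hbd 0 h0I) hφcont hφc hνt,
        heatTest_of_pos hν ht.1]
    have e2 : ∫ x, ⟪Bt x, φ x⟫ =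
        -∫ τ in (0 : ℝ)..t, ∫ y, ⟪u τ y, convect (u τ) (heatTest ν φ (t - τ)) y⟫ :=
      integral_inner_oseenDuhamel_eq_neg_intervalIntegral hν hmeas hM.le hbd' ht.1 ht.2 hφ hφd
    -- integrability of the pairings
    have hφI : Integrable φ (volume : Measure E) := hφcont.integrable_of_hasCompactSupport hφc
    have i1 : Integrable (fun x => ⟪h x, φ x⟫) (volume : Measure E) :=
      integrable_inner_of_hasCompactSupport_right hh_cont hφcont hφc
    have i2 : Integrable (fun x => ⟪Bt x, φ x⟫) (volume : Measure E) :=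
      integrable_inner_of_aestronglyMeasurable_of_norm_le hBt_meas hBt_bd hφI
    have i3 : Integrable (fun x => ⟪u t x, φ x⟫) (volume : Measure E) :=
      integrable_inner_of_aestronglyMeasurable_of_norm_le (hsl t htI) (hbd t htI) hφI
    have iP : ∀ i, Integrable (fun x => ⟪oseenDuhamel ν 0 (a i) (b i) t x, φ x⟫) (volume : Measure E) :=
      fun i => integrable_inner_of_aestronglyMeasurable_of_norm_le (hPi_meas i) (hPi_bd i) hφI
    have i4 : Integrable (fun x => ⟪Φ x, φ x⟫) (volume : Measure E) :=
      integrable_inner_of_aestronglyMeasurable_of_norm_le hΦ_meas hΦ_bd hφI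
    have e3 : ∫ x, ⟪Φ x, φ x⟫ = ∑ i, ∫ x, ⟪oseenDuhamel ν 0 (a i) (b i) t x, φ x⟫ := by
      rw [← integral_finsetSum _ fun i _ => iP i]
      refine integral_congr_ae (Eventually.of_forall fun x => ?_)
      simp only [hΦ, sum_inner]
    have i12 : Integrable (fun x => ⟪h x, φ x⟫ - ⟪Bt x, φ x⟫) (volume : Measure E) := i1.sub i2
    have i123 : Integrable (fun x => ⟪h x, φ x⟫ - ⟪Bt x, φ x⟫ - ⟪Φ x, φ x⟫) (volume : Measure E) :=
      i12.sub i4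
    have esplit : ∫ x, ⟪z x, φ x⟫ =
        (∫ x, ⟪h x, φ x⟫) - (∫ x, ⟪Bt x, φ x⟫) - (∫ x, ⟪Φ x, φ x⟫) - ∫ x, ⟪u t x, φ x⟫ := by
      simp only [hz, inner_sub_left]
      rw [integral_sub i123 i3, integral_sub i12 i4, integral_sub i1 i2]
    rw [esplit, e1, e2, e3, key]
    ring
  -- the annihilator lemma
  obtain ⟨c, hc⟩ := hz_div.exists_ae_eq_const_of_norm_le_of_forall_integral_inner_eq_zero hz_meas hz_bd
    hz_orth
  refine ⟨c, ?_⟩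
  filter_upwards [hc] with x hx
  simp only [hz] at hx
  rw [← hx]
  simp only [hΦ]
  abel

end Literature.Analysis.FluidPDE
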